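import Summits.QuantumFields.YangMills.Theorems.FlatTubeReductionDressedOneOrbitRateWindow
import Summits.QuantumFields.YangMills.Theorems.FemtoTransferGapSlabGround
import HarnessLib

/-!
# (EM-a) DAVIS–KAHAN TRANSFER: second moments of the EXACT eigenfunctions from near-orthonormal QUASIMODES with small residuals — the abstract half of the one-site sub-target
# `OneSiteEigenMoments` (route `FlatTubeReduction`, crux K1 `NearFlatRatioLaw` stmt-QuantumFields-24720; seat `ym-line-ftr-p1` g10; R2b1 RECORD rung — no summit statement is proved here)

(EM) (`RateTube.OneSiteEigenMoments`, p658355) asks for `∫ D·e² ≤ S·λ_b²·‖e‖²` (`D` = the one-orbit second-moment weight) for the EXACT physical eigenfunctions of the top one-site levels.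
Crux ONE already has explicit, localised TRIAL STATES for those levels (pulled-back eigenfunctions of Lüscher's matrix Hamiltonian); what is missing is (EM-b): their RESIDUALS
`‖K_B g_j − ν_j g_j‖ = O(λ_b²)·Λ` at the function level.  THIS FILE is the other, abstract half (EM-a) — pure fixed-lattice linear algebra over an exact dominating eigenfamily
`e₀,…,e_{n+1}` (tree: `exists_isPhys_eigenfamily_dominating_of_pos`):
* `quasimode_offspan_le` — a physical `g` with `‖K g − ν g‖² ≤ ρ²` and `ν ≥ λ_{n+1} + γ` has `‖g − Σ_{i≤n}⟨g,e_i⟩e_i‖² ≤ (ρ/γ)²` (the `K`-invariant splitting has no cross term and the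
  rest block is dominated by `λ_{n+1}`);
* `bessel_quasimodes_le` — for near-orthonormal `g₀…g_n` (`|⟨g_j,g_l⟩ − δ_{jl}| ≤ η`) and any unit `u`: `Σ_j ⟨u,g_j⟩² ≤ 1 + (n+1)η`;
* ★★ `eigen_moment_transfer` — for every `i ≤ n`: `∫ D·e_i² ≤ 2(1+(n+1)η)(n+1)·M + 2·D_max·ε`, `ε = (n+1)(η + (ρ/γ)²) + n(n+1)η + (n+1)η·(…)` explicit, where `M` bounds the
  quasimodes' moments `∫ D·g_j²`.  With `η, (ρ/γ)², M = O(λ_b²)` this is (EM).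
So (EM) ⟸ (EM-b): near-orthonormal physical quasimodes for the top `n+1` one-site levels with residuals `O(λ_b²)Λ`, moments `O(λ_b²)`, and a cluster gap `γ ≍ λ_bΛ` below them.
HONEST FRAMING: abstract; (EM-b) is OPEN (function-level Trotter/Laplace for crux ONE's trial states); femto rung R2b1 (RECORD label); not infinite volume, not a gap, not Clay.
No defs, no named facts, no `sorry`.
-/

set_option autoImplicit false

noncomputable section

open MeasureTheory Filter Topology Real
open scoped BigOperators
open Literature.MathematicalPhysics.QuantumFieldTheory
open Literature.MathematicalPhysics.QuantumLattice

namespace Summit.QuantumFields.YangMills.Theorems.FemtoTransferGap.RateTube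

open Summit.QuantumFields.YangMills.Theorems.FemtoTransferGap
open Summit.QuantumFields.YangMills.Theorems.FemtoTransferGap.OffTube
open Summit.QuantumFields.YangMills.Theorems.FemtoTransferGap.TwoLattice.ConstTube (l2_self_eq_integral_sq)

variable {L : ℕ} [NeZero L]

/-! ## §1 A quasimode is close to the top spectral subspace -/

/-- **Davis–Kahan, one vector.**  `e₀,…,e_m` an `l2`-orthonormal physical exact eigenfamily with domination at the last index (`ψ ⊥ e_{<m} ⇒ ⟨ψ,Kψ⟩ ≤ λ_m‖ψ‖²`); `g` physical with
residual `‖K_βg − νg‖² ≤ ρ²` and `λ_m + γ ≤ ν`, `γ > 0`.  Then the component of `g` off `span(e_{<m})` is small: `‖g − Σ_{i<m}⟨g,e_i⟩e_i‖² ≤ (ρ/γ)²`. [cite: ReedSimonIV1978, Thm. XIII.1] -/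
theorem quasimode_offspan_le {β : ℝ} {m : ℕ} {e : Fin (m + 1) → GaugeConfig 3 L SU2 → ℝ} (he : ∀ i, IsPhys (e i))
    (hon : ∀ i l, l2 (e i) (e l) = if i = l then 1 else 0)
    (heig : ∀ i : Fin (m + 1), transferApply β (e i) = levelValue su2Rep L β (i : ℕ) • e i)
    (hdom : ∀ (j : Fin (m + 1)) (ψ : GaugeConfig 3 L SU2 → ℝ), IsPhys ψ → (∀ i : Fin (m + 1), i < j → l2 ψ (e i) = 0) →
      qform su2Rep β ψ ψ ≤ levelValue su2Rep L β j * l2 ψ ψ)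
    {g : GaugeConfig 3 L SU2 → ℝ} (hg : IsPhys g) {ν ρ γ : ℝ} (hγ : 0 < γ) (hρ : 0 ≤ ρ) (hν : levelValue su2Rep L β m + γ ≤ ν)
    (hres : l2 (fun U => transferApply β g U - ν * g U) (fun U => transferApply β g U - ν * g U) ≤ ρ ^ 2) :
    l2 g g - ∑ i : Fin (m + 1), (if (i : ℕ) < m then l2 g (e i) else 0) ^ 2 ≤ (ρ / γ) ^ 2 ∧
    0 ≤ l2 g g - ∑ i : Fin (m + 1), (if (i : ℕ) < m then l2 g (e i) else 0) ^ 2 := by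
  classical
  set c : Fin (m + 1) → ℝ := fun i => if (i : ℕ) < m then l2 g (e i) else 0 with hcdef
  set P : GaugeConfig 3 L SU2 → ℝ := fun U => ∑ i, c i * e i U with hPdef
  have hP : IsPhys P := isPhys_sum_mul_lat Finset.univ e he c
  set Q : GaugeConfig 3 L SU2 → ℝ := fun U => g U - P U with hQdef
  have hQ : IsPhys Q := OpPlat.isPhys_sub hg hP
  set r : GaugeConfig 3 L SU2 → ℝ := fun U => transferApply β g U - ν * g U with hrdef
  have hKg : IsPhys (transferApply β g) := isPhys_transferApply β hg
  have hr : IsPhys r := by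
    have e1 : r = transferApply β g + (-ν) • g := by funext U; simp only [hrdef, Pi.add_apply, Pi.smul_apply, smul_eq_mul]; ring
    rw [e1]; exact hKg.add (hg.smul _)
  -- coefficient facts
  have hcc : ∀ i, c i * l2 g (e i) = c i ^ 2 := fun i => by
    by_cases hi : (i : ℕ) < m <;> simp [hcdef, hi, sq]
  have hPe : ∀ i, l2 P (e i) = c i := fun i => by
    rw [hPdef, l2_sum_mul_left_lat Finset.univ e he c (he i)]
    rw [Finset.sum_eq_single i (fun j _ hji => by rw [hon]; simp [hji]) (fun h => (h (Finset.mem_univ i)).elim)]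
    rw [hon]; simp
  have hQe : ∀ i : Fin (m + 1), (i : ℕ) < m → l2 Q (e i) = 0 := fun i hi => by
    have e1 : Q = g + (-1 : ℝ) • P := by funext U; simp only [hQdef, Pi.add_apply, Pi.smul_apply, smul_eq_mul]; ring
    rw [e1, l2_add_left hg (hP.smul _) (he i), l2_smul_left, hPe i]
    simp only [hcdef, hi, if_true]; ring
  obtain ⟨hPP, -⟩ := forms_of_eigenfamily_lat he hon heig c
  have hgP : l2 g P = ∑ i, c i ^ 2 := by
    rw [l2_comm, hPdef, l2_sum_mul_left_lat Finset.univ e he c hg]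
    exact Finset.sum_congr rfl fun i _ => by rw [l2_comm]; exact hcc i
  have hPQ : l2 P Q = 0 := by
    rw [hPdef, l2_sum_mul_left_lat Finset.univ e he c hQ]
    refine Finset.sum_eq_zero fun i _ => ?_
    by_cases hi : (i : ℕ) < m
    · rw [l2_comm, hQe i hi, mul_zero]
    · simp only [hcdef, hi, if_false, zero_mul]
  have hsplit : g = P + Q := by funext U; simp only [hQdef, Pi.add_apply]; ring
  -- `‖Q‖² = ‖g‖² − Σ c²`
  have hQQ : l2 Q Q = l2 g g - ∑ i, c i ^ 2 := by
    have h := l2_add_add hP hQ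
    rw [← hsplit, hPP, hPQ] at h
    linarith
  have hQ0 : 0 ≤ l2 Q Q := l2_self_nonneg_lat Q
  refine ⟨?_, by rw [← hQQ]; exact hQ0⟩
  rw [← hQQ]
  -- domination of the rest: `qform Q Q ≤ λ_m ‖Q‖²`
  have hdomQ : qform su2Rep β Q Q ≤ levelValue su2Rep L β m * l2 Q Q := by
    have := hdom (Fin.last m) Q hQ (fun i hi => hQe i (by simpa [Fin.lt_def, Fin.val_last] using hi))
    simpa [Fin.val_last] using this
  -- `qform Q Q = qform Q g = ν ‖Q‖² + ⟨Q, r⟩` (no cross term with the span; `K g = ν g + r`)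
  have hQKP : qform su2Rep β Q P = 0 := by
    rw [qform_su2Rep_comm β hQ hP, hPdef, qform_sum_mul_left_lat Finset.univ β e he c hQ]
    refine Finset.sum_eq_zero fun i _ => ?_
    by_cases hi : (i : ℕ) < m
    · rw [qform_su2Rep_comm β (he i) hQ, qform_eigen_right β (heig i), hQe i hi, mul_zero, mul_zero]
    · simp only [hcdef, hi, if_false, zero_mul]
  have hQKQ : qform su2Rep β Q Q = ν * l2 Q Q + l2 Q r := by
    have h1 : qform su2Rep β Q g = qform su2Rep β Q P + qform su2Rep β Q Q := by
      conv_lhs => rw [hsplit]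
      exact qform_add_right β hQ hP hQ
    have h2 : qform su2Rep β Q g = l2 Q (transferApply β g) := qform_eq_l2_transferApply β Q g
    have h3 : l2 Q (transferApply β g) = ν * l2 Q g + l2 Q r := by
      have e1 : transferApply β g = ν • g + r := by funext U; simp only [hrdef, Pi.add_apply, Pi.smul_apply, smul_eq_mul]; ring
      rw [e1, l2_comm, l2_add_left (hg.smul ν) hr hQ, l2_smul_left, l2_comm g Q, l2_comm r Q]
    have h4 : l2 Q g = l2 Q Q := by
      conv_lhs => rw [hsplit]
      rw [l2_comm, l2_add_left hP hQ hQ, hPQ, zero_add, l2_comm]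
    rw [hQKP, zero_add] at h1
    rw [← h1, h2, h3, h4]
  -- `γ ‖Q‖² ≤ ‖Q‖·ρ`
  have hCS : |l2 Q r| ≤ Real.sqrt (l2 Q Q) * Real.sqrt (l2 r r) := VacDict.abs_l2_le_sqrt_mul_sqrt hQ hr
  have hrρ : Real.sqrt (l2 r r) ≤ ρ := by
    rw [← Real.sqrt_sq hρ]; exact Real.sqrt_le_sqrt hres
  have hkey : γ * l2 Q Q ≤ Real.sqrt (l2 Q Q) * ρ := by
    have h1 : ν * l2 Q Q + l2 Q r ≤ levelValue su2Rep L β m * l2 Q Q := by rw [← hQKQ]; exact hdomQ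
    have h2 : -l2 Q r ≤ Real.sqrt (l2 Q Q) * ρ :=
      (neg_le_abs _).trans (hCS.trans (mul_le_mul_of_nonneg_left hrρ (Real.sqrt_nonneg _)))
    nlinarith [h1, h2, hν, hQ0]
  -- conclude `‖Q‖² ≤ (ρ/γ)²`
  have hs := Real.sqrt_nonneg (l2 Q Q)
  have hsq : Real.sqrt (l2 Q Q) * Real.sqrt (l2 Q Q) = l2 Q Q := Real.mul_self_sqrt hQ0
  have hs_le : Real.sqrt (l2 Q Q) ≤ ρ / γ := by
    rw [le_div_iff₀ hγ]
    by_cases h0 : Real.sqrt (l2 Q Q) = 0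
    · rw [h0, zero_mul]; exact hρ
    · have hpos : 0 < Real.sqrt (l2 Q Q) := lt_of_le_of_ne hs (Ne.symm h0)
      have : γ * (Real.sqrt (l2 Q Q) * Real.sqrt (l2 Q Q)) ≤ Real.sqrt (l2 Q Q) * ρ := by rw [hsq]; exact hkey
      nlinarith
  calc l2 Q Q = Real.sqrt (l2 Q Q) ^ 2 := by rw [sq, hsq]
    _ ≤ (ρ / γ) ^ 2 := pow_le_pow_left₀ hs hs_le 2

/-! ## §2 Bessel for near-orthonormal quasimodes -/

/-- **Bessel-type bound for a near-orthonormal family**: `|⟨g_j,g_l⟩ − δ_{jl}| ≤ η` and `‖u‖² = 1` give `Σ_j ⟨u,g_j⟩² ≤ 1 + (n+1)η`. [folklore] -/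
theorem bessel_quasimodes_le {n : ℕ} {g : Fin (n + 1) → GaugeConfig 3 L SU2 → ℝ} (hg : ∀ j, IsPhys (g j)) {η : ℝ} (hη : 0 ≤ η)
    (hgram : ∀ j l, |l2 (g j) (g l) - (if j = l then 1 else 0)| ≤ η) {u : GaugeConfig 3 L SU2 → ℝ} (hu : IsPhys u) (hu1 : l2 u u = 1) :
    ∑ j, l2 u (g j) ^ 2 ≤ 1 + (n + 1) * η := by
  classical
  set a : Fin (n + 1) → ℝ := fun j => l2 u (g j) with hadef
  set S : ℝ := ∑ j, a j ^ 2 with hSdef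
  have hS0 : 0 ≤ S := Finset.sum_nonneg fun j _ => sq_nonneg _
  set h : GaugeConfig 3 L SU2 → ℝ := fun U => ∑ j, a j * g j U with hhdef
  have hh : IsPhys h := isPhys_sum_mul_lat Finset.univ g hg a
  -- `S = ⟨u, h⟩`
  have hSuh : S = l2 u h := by
    rw [l2_comm, hhdef, l2_sum_mul_left_lat Finset.univ g hg a hu]
    exact Finset.sum_congr rfl fun j _ => by rw [l2_comm, hadef, sq]
  -- `‖h‖² ≤ S (1 + (n+1)η)`
  have hhh : l2 h h ≤ S * (1 + (n + 1) * η) := by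
    rw [hhdef, l2_sum_mul_sum_mul_lat Finset.univ g hg a a]
    have h1 : ∀ j l, a j * a l * l2 (g j) (g l) ≤ a j * a l * (if j = l then 1 else 0) + |a j| * |a l| * η := by
      intro j l
      have h2 := hgram j l
      have h3 : |a j * a l * (l2 (g j) (g l) - (if j = l then 1 else 0))| ≤ |a j| * |a l| * η := by
        rw [abs_mul, abs_mul]; exact mul_le_mul_of_nonneg_left h2 (by positivity)
      have h4 := le_abs_self (a j * a l * (l2 (g j) (g l) - (if j = l then 1 else 0)))
      nlinarith [h3, h4]
    calc ∑ j, ∑ l, a j * a l * l2 (g j) (g l) ≤ ∑ j, ∑ l, (a j * a l * (if j = l then 1 else 0) + |a j| * |a l| * η) :=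
          Finset.sum_le_sum fun j _ => Finset.sum_le_sum fun l _ => h1 j l
      _ = S + η * (∑ j, |a j|) ^ 2 := by
          rw [Finset.sum_congr rfl fun j _ => Finset.sum_add_distrib, Finset.sum_add_distrib]
          congr 1
          · rw [hSdef]; exact Finset.sum_congr rfl fun j _ => by
              rw [Finset.sum_eq_single j (fun l _ hlj => by simp [Ne.symm hlj]) (fun h => (h (Finset.mem_univ j)).elim)]; simp [sq]
          · rw [sq, Finset.sum_mul_sum, Finset.mul_sum]
            exact Finset.sum_congr rfl fun j _ => by rw [Finset.mul_sum]; exact Finset.sum_congr rfl fun l _ => by ring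
      _ ≤ S + η * ((n + 1) * S) := by
          have hcs : (∑ j, |a j|) ^ 2 ≤ (n + 1) * S := by
            have h := Finset.sum_mul_sq_le_sq_mul_sq Finset.univ (fun _ : Fin (n + 1) => (1 : ℝ)) (fun j => |a j|)
            simp only [one_mul, one_pow, Finset.sum_const, Finset.card_univ, Fintype.card_fin, nsmul_eq_mul, mul_one, sq_abs] at h
            push_cast at h
            rw [hSdef]; exact h
          nlinarith [mul_le_mul_of_nonneg_left hcs hη]
      _ = S * (1 + (n + 1) * η) := by ring
  -- `S² = ⟨u,h⟩² ≤ ‖u‖²‖h‖² = ‖h‖² ≤ S(1+(n+1)η)`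
  have hS2 : S ^ 2 ≤ S * (1 + (n + 1) * η) := by
    have := sq_l2_le hu hh
    rw [← hSuh, hu1, one_mul] at this
    exact this.trans hhh
  by_cases hS : S = 0
  · rw [hS]; positivity
  · have hSpos : 0 < S := lt_of_le_of_ne hS0 (Ne.symm hS)
    nlinarith

/-! ## §3 ★★ The transfer: eigenfunction second moments from quasimode data -/

set_option maxHeartbeats 400000 in
/-- ★★ **(EM-a) EIGENFUNCTION SECOND MOMENTS FROM QUASIMODES.**  Exact dominating eigenfamily `e₀,…,e_{n+1}`; near-orthonormal physical quasimodes `g₀,…,g_n` (`|⟨g_j,g_l⟩ − δ_{jl}| ≤ η`,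
`η ≤ 1/(n+1)`) with residuals `‖K g_j − ν_j g_j‖² ≤ ρ²` and `λ_{n+1} + γ ≤ ν_j` (`γ > 0`); a weight `0 ≤ D ≤ D_max` with `∫ D g_j² ≤ M`.  Then for every `i ≤ n`:
`∫ D·e_i² ≤ 2(1 + (n+1)η)(n+1)M + 2D_max·((n+1)((n+1)η + (ρ/γ)²) + (n+1)η)`. [cite: ReedSimonIV1978, Thm. XIII.1] -/
theorem eigen_moment_transfer {β : ℝ} {n : ℕ} {e : Fin (n + 2) → GaugeConfig 3 L SU2 → ℝ} (he : ∀ i, IsPhys (e i))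
    (hon : ∀ i l, l2 (e i) (e l) = if i = l then 1 else 0)
    (heig : ∀ i : Fin (n + 2), transferApply β (e i) = levelValue su2Rep L β (i : ℕ) • e i)
    (hdom : ∀ (j : Fin (n + 2)) (ψ : GaugeConfig 3 L SU2 → ℝ), IsPhys ψ → (∀ i : Fin (n + 2), i < j → l2 ψ (e i) = 0) →
      qform su2Rep β ψ ψ ≤ levelValue su2Rep L β j * l2 ψ ψ)
    {g : Fin (n + 1) → GaugeConfig 3 L SU2 → ℝ} (hg : ∀ j, IsPhys (g j)) {η : ℝ} (hη : 0 ≤ η) (hη1 : (n + 1) * η ≤ 1)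
    (hgram : ∀ j l, |l2 (g j) (g l) - (if j = l then 1 else 0)| ≤ η)
    {ν : Fin (n + 1) → ℝ} {ρ γ : ℝ} (hγ : 0 < γ) (hρ : 0 ≤ ρ) (hν : ∀ j, levelValue su2Rep L β (n + 1) + γ ≤ ν j)
    (hres : ∀ j, l2 (fun U => transferApply β (g j) U - ν j * g j U) (fun U => transferApply β (g j) U - ν j * g j U) ≤ ρ ^ 2)
    {D : GaugeConfig 3 L SU2 → ℝ} (hDm : Measurable D) (hD0 : ∀ U, 0 ≤ D U) {Dmax : ℝ} (hDb : ∀ U, |D U| ≤ Dmax) {M : ℝ}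
    (hM : ∀ j, ∫ U, D U * g j U ^ 2 ∂configMeasure SU2 L ≤ M) (i₀ : Fin (n + 2)) (hi₀ : (i₀ : ℕ) ≤ n) :
    ∫ U, D U * e i₀ U ^ 2 ∂configMeasure SU2 L ≤
      2 * (1 + (n + 1) * η) * ((n + 1) * M) + 2 * Dmax * ((n + 1) * ((n + 1) * η + (ρ / γ) ^ 2) + (n + 1) * η) := by
  classical
  have hDmax0 : 0 ≤ Dmax := (abs_nonneg _).trans (hDb 1)
  -- §1 for every quasimode: `‖g_j‖² − Σ_{i≤n} ⟨g_j,e_i⟩² ≤ (ρ/γ)²`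
  have hoff : ∀ j, l2 (g j) (g j) - ∑ i : Fin (n + 2), (if (i : ℕ) < n + 1 then l2 (g j) (e i) else 0) ^ 2 ≤ (ρ / γ) ^ 2 := fun j =>
    (quasimode_offspan_le (m := n + 1) he hon heig hdom (hg j) hγ hρ (hν j) (hres j)).1
  -- the overlap matrix `T i j = ⟨e_i, g_j⟩²` and its row sums `S i`
  set S : Fin (n + 2) → ℝ := fun i => ∑ j, l2 (e i) (g j) ^ 2 with hSdef
  have hS0 : ∀ i, 0 ≤ S i := fun i => Finset.sum_nonneg fun j _ => sq_nonneg _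
  have he1 : ∀ i, l2 (e i) (e i) = 1 := fun i => by rw [hon]; simp
  have hSup : ∀ i, S i ≤ 1 + (n + 1) * η := fun i => bessel_quasimodes_le hg hη hgram (he i) (he1 i)
  -- column sums: `Σ_{i ≤ n} ⟨e_i,g_j⟩² ≥ 1 − η − (ρ/γ)²`
  have hcol : ∀ j, 1 - η - (ρ / γ) ^ 2 ≤ ∑ i : Fin (n + 2), (if (i : ℕ) < n + 1 then l2 (e i) (g j) ^ 2 else 0) := by
    intro j
    have h1 := hoff j
    have h2 : 1 - η ≤ l2 (g j) (g j) := by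
      have := hgram j j; simp only [if_true] at this; have := (abs_le.mp this).1; linarith
    have h3 : ∑ i : Fin (n + 2), (if (i : ℕ) < n + 1 then l2 (g j) (e i) else 0) ^ 2 = ∑ i : Fin (n + 2), (if (i : ℕ) < n + 1 then l2 (e i) (g j) ^ 2 else 0) :=
      Finset.sum_congr rfl fun i _ => by by_cases hi : (i : ℕ) < n + 1 <;> simp [hi, l2_comm]
    linarith [h1, h2, h3]
  -- total: `Σ_{i ≤ n} S i ≥ (n+1)(1 − η − (ρ/γ)²)`
  have htot : (n + 1) * (1 - η - (ρ / γ) ^ 2) ≤ ∑ i : Fin (n + 2), (if (i : ℕ) < n + 1 then S i else 0) := by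
    have h1 : ∑ i : Fin (n + 2), (if (i : ℕ) < n + 1 then S i else 0) = ∑ j : Fin (n + 1), ∑ i : Fin (n + 2), (if (i : ℕ) < n + 1 then l2 (e i) (g j) ^ 2 else 0) := by
      rw [Finset.sum_comm]
      refine Finset.sum_congr rfl fun i _ => ?_
      by_cases hi : (i : ℕ) < n + 1
      · simp only [hi, if_true, hSdef]
      · simp only [hi, if_false, Finset.sum_const_zero]
    rw [h1]
    have h2 : ∑ _j : Fin (n + 1), (1 - η - (ρ / γ) ^ 2) ≤ ∑ j : Fin (n + 1), ∑ i : Fin (n + 2), (if (i : ℕ) < n + 1 then l2 (e i) (g j) ^ 2 else 0) :=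
      Finset.sum_le_sum fun j _ => hcol j
    rw [Finset.sum_const, Finset.card_univ, Fintype.card_fin, nsmul_eq_mul] at h2
    push_cast at h2
    linarith [h2]
  -- hence `S i₀ ≥ 1 − c₁`
  set c₁ : ℝ := (n + 1) * ((n + 1) * η + (ρ / γ) ^ 2) with hc₁
  have hSlow : 1 - c₁ ≤ S i₀ := by
    have hi₀' : (i₀ : ℕ) < n + 1 := Nat.lt_succ_of_le hi₀
    -- split the sum at `i₀`
    have h1 : ∑ i : Fin (n + 2), (if (i : ℕ) < n + 1 then S i else 0) =
        S i₀ + ∑ i ∈ Finset.univ.erase i₀, (if (i : ℕ) < n + 1 then S i else 0) := by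
      rw [← Finset.add_sum_erase _ _ (Finset.mem_univ i₀)]; simp [hi₀']
    have h2 : ∑ i ∈ Finset.univ.erase i₀, (if (i : ℕ) < n + 1 then S i else 0) ≤ n * (1 + (n + 1) * η) := by
      -- at most `n` nonzero terms (indices `< n+1` other than `i₀`), each `≤ 1 + (n+1)η`
      have h3 : ∑ i ∈ Finset.univ.erase i₀, (if (i : ℕ) < n + 1 then S i else 0) ≤
          ∑ i ∈ Finset.univ.erase i₀, (if (i : ℕ) < n + 1 then (1 + (n + 1) * η) else 0) :=
        Finset.sum_le_sum fun i _ => by by_cases hi : (i : ℕ) < n + 1 <;> simp [hi, hSup i]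
      refine h3.trans ?_
      have h4 : ∑ i ∈ Finset.univ.erase i₀, (if (i : ℕ) < n + 1 then (1 + (n + 1) * η) else (0 : ℝ)) =
          (1 + (n + 1) * η) * ((Finset.univ.erase i₀).filter (fun i : Fin (n + 2) => (i : ℕ) < n + 1)).card := by
        rw [← Finset.sum_filter, Finset.sum_const, nsmul_eq_mul, mul_comm]
      rw [h4]
      have h5 : ((Finset.univ.erase i₀).filter (fun i : Fin (n + 2) => (i : ℕ) < n + 1)).card ≤ n := by
        have h6 : (Finset.univ.erase i₀).filter (fun i : Fin (n + 2) => (i : ℕ) < n + 1) ⊆ (Finset.univ.filter (fun i : Fin (n + 2) => (i : ℕ) < n + 1)).erase i₀ := by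
          intro i hi
          simp only [Finset.mem_filter, Finset.mem_erase, Finset.mem_univ, true_and, and_true] at hi ⊢
          exact ⟨hi.1, hi.2⟩
        have h7 : (Finset.univ.filter (fun i : Fin (n + 2) => (i : ℕ) < n + 1)).card = n + 1 := by
          have : Finset.univ.filter (fun i : Fin (n + 2) => (i : ℕ) < n + 1) = Finset.univ.image (Fin.castSucc : Fin (n + 1) → Fin (n + 2)) := by
            ext i
            simp only [Finset.mem_filter, Finset.mem_univ, true_and, Finset.mem_image]
            constructor
            · intro hi; exact ⟨⟨i, hi⟩, Fin.ext rfl⟩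
            · rintro ⟨j, rfl⟩; exact j.isLt
          rw [this, Finset.card_image_of_injective _ (Fin.castSucc_injective _)]; simp
        have h8 := Finset.card_le_card h6
        have hmem : i₀ ∈ Finset.univ.filter (fun i : Fin (n + 2) => (i : ℕ) < n + 1) := Finset.mem_filter.mpr ⟨Finset.mem_univ _, hi₀'⟩
        rw [Finset.card_erase_of_mem hmem, h7] at h8
        simpa using h8
      have h9 : (0 : ℝ) ≤ 1 + (n + 1) * η := by positivity
      calc (1 + (n + 1) * η) * (((Finset.univ.erase i₀).filter (fun i : Fin (n + 2) => (i : ℕ) < n + 1)).card : ℝ) ≤ (1 + (n + 1) * η) * n :=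
            mul_le_mul_of_nonneg_left (by exact_mod_cast h5) h9
        _ = n * (1 + (n + 1) * η) := by ring
    have h10 := htot
    rw [h1] at h10
    rw [hc₁]; nlinarith [h10, h2]
  -- the approximant `ĝ = Σ_j ⟨e_{i₀},g_j⟩ g_j` and `‖e − ĝ‖² ≤ ε`
  set a : Fin (n + 1) → ℝ := fun j => l2 (e i₀) (g j) with hadef
  set gh : GaugeConfig 3 L SU2 → ℝ := fun U => ∑ j, a j * g j U with hghdef
  have hgh : IsPhys gh := isPhys_sum_mul_lat Finset.univ g hg a
  have hegh : l2 (e i₀) gh = S i₀ := by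
    rw [l2_comm, hghdef, l2_sum_mul_left_lat Finset.univ g hg a (he i₀)]
    exact Finset.sum_congr rfl fun j _ => by rw [l2_comm, hadef, sq]
  have hghgh : l2 gh gh ≤ S i₀ * (1 + (n + 1) * η) := by
    -- as in `bessel_quasimodes_le`: `‖Σ a g‖² ≤ Σa² + η (Σ|a|)² ≤ S (1 + (n+1)η)`
    rw [hghdef, l2_sum_mul_sum_mul_lat Finset.univ g hg a a]
    have h1 : ∀ j l, a j * a l * l2 (g j) (g l) ≤ a j * a l * (if j = l then 1 else 0) + |a j| * |a l| * η := by
      intro j l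
      have h3 : |a j * a l * (l2 (g j) (g l) - (if j = l then 1 else 0))| ≤ |a j| * |a l| * η := by
        rw [abs_mul, abs_mul]; exact mul_le_mul_of_nonneg_left (hgram j l) (by positivity)
      have h4 := le_abs_self (a j * a l * (l2 (g j) (g l) - (if j = l then 1 else 0)))
      nlinarith [h3, h4]
    have hcs : (∑ j, |a j|) ^ 2 ≤ (n + 1) * S i₀ := by
      have h := Finset.sum_mul_sq_le_sq_mul_sq Finset.univ (fun _ : Fin (n + 1) => (1 : ℝ)) (fun j => |a j|)
      simp only [one_mul, one_pow, Finset.sum_const, Finset.card_univ, Fintype.card_fin, nsmul_eq_mul, mul_one, sq_abs] at h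
      push_cast at h
      simpa [hSdef, hadef] using h
    calc ∑ j, ∑ l, a j * a l * l2 (g j) (g l) ≤ ∑ j, ∑ l, (a j * a l * (if j = l then 1 else 0) + |a j| * |a l| * η) :=
          Finset.sum_le_sum fun j _ => Finset.sum_le_sum fun l _ => h1 j l
      _ = S i₀ + η * (∑ j, |a j|) ^ 2 := by
          rw [Finset.sum_congr rfl fun j _ => Finset.sum_add_distrib, Finset.sum_add_distrib]
          congr 1
          · exact Finset.sum_congr rfl fun j _ => by
              rw [Finset.sum_eq_single j (fun l _ hlj => by simp [Ne.symm hlj]) (fun h => (h (Finset.mem_univ j)).elim)]; simp [sq, hadef]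
          · rw [sq, Finset.sum_mul_sum, Finset.mul_sum]
            exact Finset.sum_congr rfl fun j _ => by rw [Finset.mul_sum]; exact Finset.sum_congr rfl fun l _ => by ring
      _ ≤ S i₀ * (1 + (n + 1) * η) := by nlinarith [mul_le_mul_of_nonneg_left hcs hη, hS0 i₀]
  set dif : GaugeConfig 3 L SU2 → ℝ := fun U => e i₀ U - gh U with hdif
  have hdifP : IsPhys dif := OpPlat.isPhys_sub (he i₀) hgh
  have hdif2 : l2 dif dif ≤ (n + 1) * η + c₁ := by
    have e1 : dif = e i₀ + (-1 : ℝ) • gh := by funext U; simp only [hdif, Pi.add_apply, Pi.smul_apply, smul_eq_mul]; ring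
    have h1 : l2 dif dif = 1 - 2 * S i₀ + l2 gh gh := by
      rw [e1, l2_add_add (he i₀) (hgh.smul _), he1, OpPlat.l2_smul_smul]
      have : l2 (e i₀) ((-1 : ℝ) • gh) = -1 * l2 (e i₀) gh := by rw [l2_comm, l2_smul_left, l2_comm]
      rw [this, hegh]; ring
    rw [h1]
    -- `1 − 2S + S(1+(n+1)η) = 1 − S(1 − (n+1)η) ≤ 1 − (1−c₁)(1−(n+1)η) ≤ (n+1)η + c₁`
    have h2 : 0 ≤ 1 - (n + 1) * η := by linarith
    have hc₁0 : 0 ≤ c₁ := by rw [hc₁]; positivity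
    have h3 : (1 - c₁) * (1 - (n + 1) * η) ≤ S i₀ * (1 - (n + 1) * η) := mul_le_mul_of_nonneg_right hSlow h2
    have h4 : 0 ≤ c₁ * ((n + 1) * η) := mul_nonneg hc₁0 (by positivity)
    linarith [hghgh, h3, h4]
  -- moments
  obtain ⟨Cd, hCd⟩ := hdifP.bounded
  have hiD : Integrable (fun U => D U * dif U ^ 2) (configMeasure SU2 L) :=
    integrable_of_measurable_abs_le _ (hDm.mul (hdifP.measurable.pow_const 2)) (C := Dmax * Cd ^ 2) fun U => by
      rw [abs_mul, abs_pow]; exact mul_le_mul (hDb U) (pow_le_pow_left₀ (abs_nonneg _) (hCd U) 2) (by positivity) hDmax0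
  have hmom_gh : ∫ U, D U * gh U ^ 2 ∂configMeasure SU2 L ≤ (n + 1) * M * S i₀ := by
    have := integral_weight_combination_sq_le hDm hDb hD0 hg hM a
    simpa [hghdef, hSdef, hadef] using this
  have hmom_dif : ∫ U, D U * dif U ^ 2 ∂configMeasure SU2 L ≤ Dmax * ((n + 1) * η + c₁) := by
    calc ∫ U, D U * dif U ^ 2 ∂configMeasure SU2 L ≤ ∫ U, Dmax * dif U ^ 2 ∂configMeasure SU2 L := by
          refine integral_mono hiD ((integrable_of_measurable_abs_le _ (hdifP.measurable.pow_const 2) (C := Cd ^ 2) fun U => by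
            rw [abs_pow]; exact pow_le_pow_left₀ (abs_nonneg _) (hCd U) 2).const_mul Dmax) fun U => ?_
          exact mul_le_mul_of_nonneg_right ((le_abs_self _).trans (hDb U)) (sq_nonneg _)
      _ = Dmax * l2 dif dif := by rw [integral_const_mul, l2_self_eq_integral_sq]
      _ ≤ Dmax * ((n + 1) * η + c₁) := mul_le_mul_of_nonneg_left hdif2 hDmax0
  -- `e = gh + dif`, `D e² ≤ 2 D gh² + 2 D dif²`
  obtain ⟨Cg, hCg⟩ := hgh.bounded
  have hiG : Integrable (fun U => D U * gh U ^ 2) (configMeasure SU2 L) :=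
    integrable_of_measurable_abs_le _ (hDm.mul (hgh.measurable.pow_const 2)) (C := Dmax * Cg ^ 2) fun U => by
      rw [abs_mul, abs_pow]; exact mul_le_mul (hDb U) (pow_le_pow_left₀ (abs_nonneg _) (hCg U) 2) (by positivity) hDmax0
  obtain ⟨Ce, hCe⟩ := (he i₀).bounded
  have hiE : Integrable (fun U => D U * e i₀ U ^ 2) (configMeasure SU2 L) :=
    integrable_of_measurable_abs_le _ (hDm.mul ((he i₀).measurable.pow_const 2)) (C := Dmax * Ce ^ 2) fun U => by
      rw [abs_mul, abs_pow]; exact mul_le_mul (hDb U) (pow_le_pow_left₀ (abs_nonneg _) (hCe U) 2) (by positivity) hDmax0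
  have hpt : ∀ U, D U * e i₀ U ^ 2 ≤ 2 * (D U * gh U ^ 2) + 2 * (D U * dif U ^ 2) := fun U => by
    have : e i₀ U = gh U + dif U := by simp only [hdif]; ring
    rw [this]; nlinarith [hD0 U, sq_nonneg (gh U - dif U), mul_nonneg (hD0 U) (sq_nonneg (gh U - dif U))]
  calc ∫ U, D U * e i₀ U ^ 2 ∂configMeasure SU2 L ≤ ∫ U, 2 * (D U * gh U ^ 2) + 2 * (D U * dif U ^ 2) ∂configMeasure SU2 L :=
        integral_mono hiE ((hiG.const_mul 2).add (hiD.const_mul 2)) hpt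
    _ = 2 * ∫ U, D U * gh U ^ 2 ∂configMeasure SU2 L + 2 * ∫ U, D U * dif U ^ 2 ∂configMeasure SU2 L := by
        rw [integral_add (hiG.const_mul 2) (hiD.const_mul 2), integral_const_mul, integral_const_mul]
    _ ≤ 2 * ((n + 1) * M * S i₀) + 2 * (Dmax * ((n + 1) * η + c₁)) := by linarith [hmom_gh, hmom_dif]
    _ ≤ 2 * (1 + (n + 1) * η) * ((n + 1) * M) + 2 * Dmax * ((n + 1) * ((n + 1) * η + (ρ / γ) ^ 2) + (n + 1) * η) := by
        have hM0 : 0 ≤ M := le_trans (integral_nonneg fun U => mul_nonneg (hD0 U) (sq_nonneg _)) (hM 0)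
        have h1 : (n + 1) * M * S i₀ ≤ (1 + (n + 1) * η) * ((n + 1) * M) := by
          have := mul_le_mul_of_nonneg_left (hSup i₀) (by positivity : (0 : ℝ) ≤ (n + 1) * M); linarith
        rw [hc₁]; nlinarith [h1, hDmax0]

end Summit.QuantumFields.YangMills.Theorems.FemtoTransferGap.RateTube

end
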